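import Summits.ResolutionOfSingularities.ResolutionOfSingularities.Theorems.EquisingularLiftEquisingularLiftNatUncentredConeGermConeForm
import Summits.ResolutionOfSingularities.ResolutionOfSingularities.Theorems.EquisingularLiftEquisingularLiftNatTCPlusMemberUncentred
import Summits.ResolutionOfSingularities.ResolutionOfSingularities.Theorems.EquisingularLiftEquisingularLiftNatStrictTransformExceptionalCartier
import Summits.ResolutionOfSingularities.ResolutionOfSingularities.Theorems.EquisingularLiftEquisingularLiftNatSubchainSupplierInvKDefs
import HarnessLib

/-!
# [OURS · L1 W4.5(b) · EL♮(3)] S7 — THE UNCENTRED MEMBER WITH THE LOCALIZED SHADOW TRACE AND THE CARTIER CLAUSE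
# `TCPlus.MemberKCL O k θ P q Y Ch F₂ T₂ Z₂ (St_x W) ∅` (crux `EquisingularLiftNatThree` = stmt-ResolutionOfSingularities-20148)

res-type-100 g12, object S7 `hBaseKCL` of res-D-pv-029's TOWER₃ assembly (res-L1-w45b-plan-1 CHAIN v7.31 §1(1); res-D-pv-029 DECISION
2026-08-27T20:53:20Z: repair (R1), currency `TCPlus.MemberKCL`/`InvKCL`, …NatSubchainSupplierInvKDefs v3 p570160). OURS; NOT a statement of any
manuscript; AI-written, weaker than expert review; `--supports stmt-ResolutionOfSingularities-20148 --as helper`; closes nothing. Definition-free.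

* `tcPlus_memberKCL_uncentred` — B9's uncentred member `tcPlus_member_uncentred` (…NatTCPlusMemberUncentred) RE-ASSEMBLED over the cone germ in
  the `ConeForm` frame (`exists_coneGerm_of_admTC_coneForm`, …NatUncentredConeGermConeForm): the same witnesses (`X₁`, `τ₁ ≫ σ'`, `j₂`, `t₂`,
  `E = (ker s)·𝒪_{X₁}`, `K = St_{τ₁} K₀`), clauses (i)–(vi) verbatim, (vii-loc) from the cone germ, (viii) by
  `isEffectiveCartier_comap_subschemeι_strictTransformIdeal` (…NatStrictTransformExceptionalCartier). Hypotheses: those of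
  `tcPlus_member_uncentred` with `x ∈ W` and the principal affine open REPLACED by `ConeForm F₁ x W` (res-L1-w45b-lead-2, …NatTowerConeDefs),
  and `k` of prime characteristic `p` (`[CharP k p]`, as in the crux).

References: H. Matsumura, *Commutative Ring Theory* (1986), Thm. 14.2; The Stacks Project, Tag 0804 — through the cited tree files.
-/

set_option linter.dupNamespace false -- mandated namespace `Summit.<Summit>.<Problem>` of this single-conjunct summit
set_option linter.overlappingInstances false -- the binders carry `[IsDomain O] [IsDiscreteValuationRing O]`

noncomputable section

open CategoryTheory CategoryTheory.Limits AlgebraicGeometry TopologicalSpace IsLocalRing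
open Literature.AlgebraicGeometry.Resolution
open AlgebraicGeometry.Scheme.IdealSheafData
open Summit.ResolutionOfSingularities.ResolutionOfSingularities.Cruxes.EquisingularLift.StrataSplit

namespace Summit.ResolutionOfSingularities.ResolutionOfSingularities.Cruxes.EquisingularLiftNat.Sections

/-! ## The uncentred member with the localized shadow trace -/

/-- **`TCPlus.MemberKCL … F₂ T₂ Z₂ (St_x W) ∅` — THE UNCENTRED MEMBER OF `inv_baseKCL` WITH SHADOW AND CARTIER CLAUSES.** In the binders
of `tcPlus_member_uncentred` (…NatTCPlusMemberUncentred) with `ConeForm F₁ x W` (res-L1-w45b-lead-2, …NatTowerConeDefs) replacing the principal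
affine open, and `k` of prime characteristic `p`: the witnesses of B9's uncentred member (`X₁`, `τ₁ ≫ σ'`, `j₂`, `t₂`, `E`, `St_{τ₁} K₀` for the
cone germ of `exists_coneGerm_of_admTC_coneForm`) satisfy clauses (i)–(vi) verbatim, (vii-loc) and (viii)
(`isEffectiveCartier_comap_subschemeι_strictTransformIdeal`, …NatStrictTransformExceptionalCartier). [cite: Matsumura1987, Thm. 14.2;
StacksProject, Tag 0804] [OURS · L1 W4.5b] S7 `hBaseKCL`, uncentred member; NOT a statement of the manuscript. -/
theorem tcPlus_memberKCL_uncentred (p : ℕ) [Fact p.Prime] (k : Type) [Field k] [CharP k p] [IsAlgClosed k] (O : Type) [CommRing O]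
    [IsDomain O] [IsDiscreteValuationRing O] [IsAdicComplete (IsLocalRing.maximalIdeal O) O] [IsAlgClosed (IsLocalRing.ResidueField O)]
    (θ : O →+* k) (hθ : Function.Surjective θ) (P : Scheme.{0}) (q : P ⟶ Spec (.of O)) (Y : Set P)
    (Ch : ∀ X' : Scheme.{0}, (X' ⟶ P) → Set X' → Prop)
    (hChSplit : ∀ (X' : Scheme.{0}) (σ' : X' ⟶ P) (S' : Set X'), Ch X' σ' S' →
      Summit.ResolutionOfSingularities.ResolutionOfSingularities.Theses.EquisingularLift.Split.Chain P Y X' σ' S')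
    (hPnoeth : IsLocallyNoetherian P) (hPreg : Scheme.IsRegular P) [IsProper q]
    (X' : Scheme.{0}) (σ' : X' ⟶ P) (S' : Set X') (hCh' : Ch X' σ' S') [IsIntegral X'] [IsLocallyNoetherian X']
    (hX'reg : Scheme.IsRegular X') (F₁ : Scheme.{0}) [IsIntegral F₁] (j : F₁ ⟶ X') (t : F₁ ⟶ Spec (.of k))
    (hsq : IsPullback j t (σ' ≫ q) (Spec.map (CommRingCat.ofHom θ))) (T₁ : Set F₁) (x : F₁) (hx : IsClosed ({x} : Set F₁))
    (U : X'.Opens) (hU : Smooth (U.ι ≫ σ' ≫ q)) (s : Spec (.of O) ⟶ X') (hs : s ≫ σ' ≫ q = 𝟙 _)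
    (hsU : s (IsLocalRing.closedPoint O) ∈ U) (hsx : s (IsLocalRing.closedPoint O) = j x)
    (hdim : ringKrullDim (X'.presheaf.stalk (s (IsLocalRing.closedPoint O))) = ((3 + 1 : ℕ) : WithBot ℕ∞))
    (hsoff : ∀ c ∈ (s.ker.support : Set X'), ¬ IsGenericPoint (σ' c) Y)
    (X₁ : Scheme.{0}) (τ₁ : X₁ ⟶ X') (hτ₁ : IsBlowup τ₁ s.ker) [IsIntegral X₁] [IsLocallyNoetherian X₁]
    (hX₁reg : Scheme.IsRegular X₁) (hX₁dom : IsDominant ((τ₁ ≫ σ') ≫ q))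
    (F₂ : Scheme.{0}) [IsIntegral F₂] (υ : F₂ ⟶ F₁) (hυ : IsBlowup υ (vanishingIdeal (⟨{x}, hx⟩ : Closeds F₁)))
    (j₂ : F₂ ⟶ X₁) (t₂ : F₂ ⟶ Spec (.of k)) (hsq₂ : IsPullback j₂ t₂ ((τ₁ ≫ σ') ≫ q) (Spec.map (CommRingCat.ofHom θ)))
    (hcomm : j₂ ≫ τ₁ = υ ≫ j) (hcarrier : (s.ker.comap τ₁).comap j₂ = (vanishingIdeal (⟨{x}, hx⟩ : Closeds F₁)).comap υ)
    (hCh₁ : Ch X₁ (τ₁ ≫ σ') (j₂ '' closure (υ ⁻¹' (T₁ \ {x}))))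
    (W : Set F₁) (hnot : ¬ (υ ⁻¹' {x} ⊆ closure (υ ⁻¹' (W \ {x})))) (hcone : ConeForm F₁ x W) :
    TCPlus.MemberKCL O k θ P q Y Ch F₂ (closure (υ ⁻¹' (T₁ \ {x}))) (υ ⁻¹' {x} ∩ closure (υ ⁻¹' (W \ {x})))
      (closure (υ ⁻¹' (W \ {x}))) ∅ := by
  -- adapted from `tcPlus_member_uncentred` (…NatTCPlusMemberUncentred): same witnesses, two more clauses
  haveI : IsProper σ' := (chain_isRegular P Y X' σ' S' (hChSplit X' σ' S' hCh') hPnoeth hPreg).2.2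
  haveI : IsProper (σ' ≫ q) := inferInstance
  have hZ : IsClosed (υ ⁻¹' {x} ∩ closure (υ ⁻¹' (W \ {x}))) := (hx.preimage υ.continuous).inter isClosed_closure
  have hsq₂' : IsPullback j₂ t₂ (τ₁ ≫ σ' ≫ q) (Spec.map (CommRingCat.ofHom θ)) := by
    simpa only [Category.assoc] using hsq₂
  -- the cone germ in the `ConeForm` frame (`n = 3`: the plane lift, no finiteness input)
  obtain ⟨hEreg, hEpr, f, hf0, hK⟩ := exists_coneGerm_of_admTC_coneForm p k 3 O θ hθ X' (σ' ≫ q) hX'reg inferInstance U hU s hs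
    hsU hdim X₁ τ₁ hτ₁ F₁ j t hsq x hx hsx F₂ υ hυ j₂ t₂ hsq₂' hcomm hcarrier W hZ hnot hcone (Or.inl rfl)
  -- the prescribed-germ Cartier divisor with germ `f`, and the clauses for its strict transform
  obtain ⟨K₀, hK₀pr, hK₀⟩ := exists_forall_isPrincipal_stalkIdeal_eq_span hX'reg (j x) hf0
  obtain ⟨hi, hii, -, hiv, hv, hcodim, -, hvii⟩ := hK K₀ hK₀
  -- the section centre is regular and non-zero
  obtain ⟨-, hsreg, -, hsupp⟩ := section_isClosedImmersion_and_isRegular_ker O X' (σ' ≫ q) s hs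
  obtain ⟨y₁⟩ := (inferInstance : Nonempty F₂)
  have hs0 : s.ker ≠ ⊥ := ne_bot_of_isBlowup hτ₁ (j₂ y₁)
  haveI : IsLocallyNoetherian X₁ := ‹_›
  refine ⟨X₁, τ₁ ≫ σ', _, j₂, t₂, s.ker.comap τ₁, strictTransformIdeal τ₁ s.ker K₀, hCh₁, ‹_›, ‹_›, hX₁reg, hX₁dom, hsq₂,
    rfl, ?_, ?_, hEreg, fun z => ⟨hEpr z, ?_⟩, ?_, fun z hz hzq _ => ⟨hv z hz, fun _ => hcodim z hz ?_⟩, ?_, ?_, ?_⟩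
  · -- (i) exact special fibre
    have hcl : (⟨closure (υ ⁻¹' {x} ∩ closure (υ ⁻¹' (W \ {x}))), isClosed_closure⟩ : Closeds F₂) =
        ⟨υ ⁻¹' {x} ∩ closure (υ ⁻¹' (W \ {x})), hZ⟩ := Closeds.ext hZ.closure_eq
    rw [hcl]; exact hi
  · -- (ii) flat over `O`
    simpa only [Category.assoc] using hii
  · -- (iii) the cone is principal at every point (res-D-pv-032, p529806)
    exact isPrincipal_stalkIdeal_strictTransformIdeal hX'reg hsreg hτ₁ hs0 K₀ hK₀pr z
  · -- (iv) off the generic points of `Y`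
    rintro _ ⟨z, hz, rfl⟩
    have hzE : τ₁ z ∈ (s.ker.support : Set X') := by
      have h := hiv hz
      rw [SetLike.mem_coe, Scheme.IdealSheafData.support_comap] at h
      exact h
    rw [Scheme.Hom.comp_apply]
    exact hsoff _ hzE
  · -- (v) the special points lie over the closed point
    simpa only [Category.assoc] using hzq
  · -- (vi) no excluded point
    intro y₀ hy₀
    exact absurd hy₀ (Set.notMem_empty _)
  · -- (vii-loc) the localized shadow trace (closure of the closed shadow)
    obtain ⟨V, hxV, hV⟩ := hvii
    have hcl : (⟨closure (closure (υ ⁻¹' (W \ {x}))), isClosed_closure⟩ : Closeds F₂) =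
        ⟨closure (υ ⁻¹' (W \ {x})), isClosed_closure⟩ := Closeds.ext closure_closure
    exact ⟨V, Set.inter_subset_left.trans hxV, by rw [hcl]; exact hV⟩
  · -- (viii) the carrier cuts an effective Cartier divisor on the cone (res-type-100, …NatStrictTransformExceptionalCartier)
    exact isEffectiveCartier_comap_subschemeι_strictTransformIdeal τ₁ s.ker K₀ hτ₁.isEffectiveCartier

end Summit.ResolutionOfSingularities.ResolutionOfSingularities.Cruxes.EquisingularLiftNat.Sections

end
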